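import Literature.AlgebraicGeometry.HodgeTheory.RankOneCentreTimesCMCurveInvariance
import Literature.AlgebraicGeometry.HodgeTheory.CMCurveTimesSimpleCMVarietyDichotomy
import Literature.AlgebraicGeometry.HodgeTheory.NoTypeIVTimesCMStablyNondegenerate
import Literature.AlgebraicGeometry.HodgeTheory.TimesNonCMCurveProductSpan
import Literature.NumberTheory.ComplexMultiplication.EllipticCurveEndomorphismRingStructure
import HarnessLib

/-!
# `E_k × T`, `T` a simple abelian threefold with `End⁰(T) = k'` imaginary quadratic, `k ≇ k'`: product span, condition (D), and the complete `E × T` row of Moonen–Zarhin's Thm. 0.1 (4) for `T` simple (Moonen–Zarhin 1999 (3.1), Lemma (3.6), Prop. (3.8))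

Family `hodge`, layer `Literature/AlgebraicGeometry/HodgeTheory`. Research context: cell `pub-hodge-ring2` (HONEST
FRAMING: research route conditional on HC_CM; not a corollary; Q11.4-sentence-2 already refuted in dim ≥ 3),
Literature lane, programme R24 — third file, drawing the consequences of the invariance theorem
`RankOneCentreTimesCMCurveInvariance` (Lie step `Motives/HodgeThetaAnnihilatorTimesRankOneTorus`). UNCONDITIONAL
(no HC_CM); theorems only (no definition, no named fact, D-0026; nothing admitted); no step towards a summit
statement beyond the printed results it formalizes.

PRINTED RESULTS. B. Moonen, Yu. Zarhin, *Hodge classes on abelian varieties of low dimension*, Math. Ann. 315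
(1999) [held: `paper:arxiv-math_9901113`, locators = held TeX chunks]: Thm. 0.1 (chunk p0001) «Let X be a complex abelian variety with `dim(X) ≤ 5` …
X is isogenous to a product `E_k × T` (case (a)) … Then (1) in these cases `D²(X) ≠ B²(X)` … (4) in all other
cases `D•(Xⁿ) = B•(Xⁿ)` for all `n`», case (a) (chunk p0001) «The abelian variety `X` is isogenous to a product `X₁ × X₂`
where `X₁` is an elliptic curve with complex multiplication by an imaginary quadratic field `k` and where `X₂` is a
simple abelian threefold such that there exists an embedding `k ↪ End⁰(X₂)`»; Thm. 0.2 (chunks p0001–p0002) with case (g)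
«`X₂` is a simple abelian fourfold such that there exists an embedding `k ↪ End⁰(X₂)` via which `k` acts on `T_{X₂,0}`
with multiplicities `(1,3)`» and (4) «Suppose we are not in one of the cases (e), (f) or (g) … Then
`Hg(X) = Hg(Y₁^{m₁}) × ⋯ Hg(Y_r^{m_r})`»; §3 (3.1) (chunk p0006); Lemma (3.6) and Prop. (3.8)
(chunk p0007) «Suppose `Hom(E,X) = 0`. Then either `Hg(X × E) = Hg(X) × Hg(E)` or `End⁰(E) = k` is an imaginary
quadratic field such that there exists an embedding of `k` into the center of `End⁰(X)`»; §2 (2.3) (chunk p0005) type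
IV(1,1) («`F` necessarily acts on the tangent space with multiplicities `(2,1)`») and p. 715 «for `g ≤ 3` …
`B(Xⁿ) = D(Xⁿ)` for all `n`»; Thm. (3.2) (chunk p0006).

THIS FILE. §1 an algebra lemma: a two-dimensional `ℚ`-algebra `K = ℚ + ℚc`, `c² = -d'`, maps to every `ℚ`-algebra
containing `b` with `b² = -d'` (`nonempty_ringHom_of_mul_self_eq_neg`; the basis `{1, c}` and `Basis.constr`), whence
(`forall_ne_sq_mul_of_isEmpty_ringHom`) NO ring homomorphism `End⁰(E) → End⁰(A)` forces `d ≠ q²d'` for the complex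
multiplications `χ ≫ χ = -d'` of the elliptic curve `E` and `φ ≫ φ = -d` of `A` («no embedding of `k` into the center
of `End⁰(X)`» ⟹ the rational independence of the `Θ`-trace slopes). §2 the PRODUCT SPAN
`HodgeClassesProductSpan B Z` for slots over `A × E` (`dim_ℚ End⁰(A) = 2`, `φ ≫ φ = -d`, `E` an elliptic curve with
`χ ≫ χ = -d'`, `d ≠ q²d'`) — the tree's `ThetaTraceTimesCMProductSpan` §5 verbatim on the new invariance theorem —
its equal-powers form, and CONDITION (D): `A` stably nondegenerate ⟹ `A × E` and `E × A` stably nondegenerate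
(`IsStablyNondegenerate.prod_cmCurve_of_quadraticEnd`). §3 **THE `E × T` ROW OF THM. 0.1 (4) FOR `T` SIMPLE,
COMPLETE**: for an elliptic curve `E` OF CM TYPE and a SIMPLE abelian threefold `T` admitting NO ring homomorphism
`End⁰(E) → End⁰(T)`, `E × T` is stably nondegenerate (`isStablyNondegenerate_cmCurve_prod_of_isSimple_threefold_of_isEmpty`;
`dim_ℚ End⁰(T) ∈ {1,2,3,6}`: `1`, `3` no type IV (the tree's R5/R22), `6` ⟹ `T` of CM type (the tree's R21
`…of_isOfCMType_of_isEmpty`), `2` ⟹ `End⁰(T) = ℚ(φ)`, `φ ≫ φ = -d` (type IV(1,1), NOT of CM type) — NEW, by §2 with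
`AbelianVariety.isStablyNondegenerate_of_isSimple_threefold_of_finrank_eq_two`); hence for EVERY elliptic curve `E`
and every simple threefold `T` with `IsEmpty (End⁰(E) →+* End⁰(T))` whenever `E` is of CM type
(`isStablyNondegenerate_curve_prod_of_isSimple_threefold`; `E` not of CM type: the tree's
`isStablyNondegenerate_nonCMCurve_prod_threefold`), with the Hodge conjecture for all powers and everything isogenous;
uniformly in the dimension, `IsStablyNondegenerate.cmCurve_prod_of_isSimple_of_finrank_eq_two_of_isEmpty` (`A` simple,
(D), `dim_ℚ End⁰(A) = 2`: real quadratic ⟹ no type IV, the tree's R5; imaginary ⟹ §2) and `E × A` for `A` of RIBET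
TYPE (`dim A ≥ 3`, `End⁰(A) ⊇ ℚ(φ)` two-dimensional, `φ` of multiplicities `(dim A - 1, 1)`; the tree's
`AbelianVariety.isDivisorGenerated_powSucc_of_ribetTypeOne`), `k ≇ ℚ(φ)` — for `dim A = 4` the FIVEFOLD row of Thm. 0.2 (4)
complementary to case (g) (`isStablyNondegenerate_cmCurve_prod_of_ribetTypeOne_of_isEmpty`).
NOT asserted: the converse for `T` of type IV(1,1) not of CM type with `k ↪ End⁰(T)` (case (a): exceptional Weil
classes, Thm. 0.1 (1)); for `T` of CM type the biconditional is the tree's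
`isStablyNondegenerate_cmCurve_prod_iff_isEmpty_of_isSimple_threefold`.

## References

* [MoonenZarhin1999LowDim] B. Moonen, Yu. Zarhin, Math. Ann. 315 (1999), Thm. 0.1 (1)/(4) with (a), §2 (2.1),
  (2.3), p. 715, §3 (3.1), Thm. (3.2), Lemma (3.6), Prop. (3.8) (held `paper:arxiv-math_9901113` chunks p0001–p0002, p0005–p0007). [cite: MoonenZarhin1999LowDim, Thm. 0.1 (4) and §3 Prop. (3.8)]
* [Lombardo2016] D. Lombardo, Ann. Inst. Fourier 66 (2016), Lemma 3.4 (p. 1229). [cite: Lombardo2016, Lemma 3.4 (p. 1229)]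
* [Gordon1999HodgeAVSurvey] B. B. Gordon, App. B in Lewis' *Survey of the Hodge conjecture* (1999), Thm. 7.5, Def. 7.6. [cite: Gordon1999HodgeAVSurvey, Thm. 7.5 and Def. 7.6]
* [MumfordAV1970] D. Mumford, *Abelian Varieties*, §19 Thm. 3, Cor. 2 (pp. 173–174); §21. [cite: MumfordAV1970, §19 Cor. 2 of Thm. 1 (p. 174)]
* [Shimura1998] G. Shimura, *Abelian Varieties with Complex Multiplication and Modular Functions*, §5.1 Props. 1, 5. [cite: Shimura1998, §5.1 Proposition 1]
* [SilvermanAEC2009] J. H. Silverman, GTM 106, III.9 Cor. 9.4. [cite: SilvermanAEC2009, III.9 Cor. 9.4]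
* [Ribet1983] K. Ribet, *Hodge classes on certain types of abelian varieties*, Amer. J. Math. 105 (1983), Thm. 3. [cite: Ribet1983, Thm. 3]
* [vanGeemen1994HodgeAV] B. van Geemen, LNM 1594 (1994), §2.4, Lemma 3.7, §3.6, Thm. 4.3. [cite: vanGeemen1994HodgeAV, Lemma 3.7]
-/

noncomputable section

open scoped TensorProduct
open CategoryTheory Module NumberField

namespace Literature.AlgebraicGeometry.HodgeTheory

open Literature.AlgebraicTopology.SingularHomology
open Literature.AlgebraicGeometry.Motives (IsSmoothProjective AbelianVariety bettiCohomology
  ofRatClassBaseChange ofRatClassBaseChange_tmul HodgeTensorFacts hodgeTensorFacts_holds ComplexPoints)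
open Literature.Barriers.HodgeConjecture
open Literature.AlgebraicGeometry.Motives.HodgeStructure
open Literature.AlgebraicGeometry.Motives.AbelianVariety
open Literature.AlgebraicGeometry.ComplexMultiplication
open Literature.AlgebraicGeometry.Milne1999
open Literature.NumberTheory.ComplexMultiplication
open Literature.RepresentationTheory.GeneralLinear
open Literature.NumberTheory.DiophantineGeometry

/-! ### §1 Quadratic algebras: `ℚ + ℚc → R`, and «no embedding `k ↪ End⁰(X)`» ⟹ `d ≠ q²d'` -/

section Quadratic

/-- `(x + yc)(x' + y'c) = (xx' - d'yy') + (xy' + x'y)c` in any `ℚ`-algebra with `c² = -d'`. [folklore] -/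
private theorem quadratic_mul_expand {S : Type*} [Ring S] [Algebra ℚ S] {e : S} {d' : ℚ} (he : e * e = -(d' • 1))
    (x y x' y' : ℚ) :
    (x • (1 : S) + y • e) * (x' • 1 + y' • e) = (x * x' - d' * (y * y')) • 1 + (x * y' + x' * y) • e := by
  simp only [add_mul, mul_add, smul_mul_smul_comm, one_mul, mul_one, he, smul_neg, smul_smul]
  module

/-- **A two-dimensional `ℚ`-algebra `K ∋ c` with `c² = -d'` (`d' > 0`) admits a ring homomorphism to every
`ℚ`-algebra `R ∋ b` with `b² = -d'`** (`K = ℚ·1 ⊕ ℚ·c` — `1, c` are linearly independent since `-d'` is not a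
rational square — and `x + yc ↦ x + yb` is multiplicative). For `K = End⁰(E) = k` an imaginary quadratic field this
is the «embedding of `k`» of Prop. (3.8). [cite: MoonenZarhin1999LowDim, §3 Prop. (3.8)] [cite: Shimura1998, §5.1 Proposition 5 (p. 36)] -/
theorem nonempty_ringHom_of_mul_self_eq_neg {K R : Type*} [Ring K] [Algebra ℚ K] [Nontrivial K] [Module.Finite ℚ K]
    (hK : Module.finrank ℚ K = 2) {c : K} {d' : ℚ} (hd' : 0 < d') (hc : c * c = -(d' • 1)) [Ring R] [Algebra ℚ R]
    {b : R} (hb : b * b = -(d' • 1)) : Nonempty (K →+* R) := by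
  classical
  -- `1, c` are linearly independent
  have hli : LinearIndependent ℚ ![(1 : K), c] := by
    refine LinearIndependent.pair_iff.2 fun s t hst => ?_
    by_cases ht : t = 0
    · subst ht
      simp only [zero_smul, add_zero, smul_eq_zero, one_ne_zero, or_false] at hst
      exact ⟨hst, rfl⟩
    · exfalso
      have hcst : c = (-(s / t)) • (1 : K) := by
        have h : t • c = -(s • (1 : K)) := eq_neg_of_add_eq_zero_right hst
        have h2 : c = t⁻¹ • (t • c) := by rw [smul_smul, inv_mul_cancel₀ ht, one_smul]
        rw [h2, h, smul_neg, smul_smul, neg_smul, div_eq_inv_mul]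
      have hsq : ((s / t) ^ 2 + d') • (1 : K) = 0 := by
        rw [add_smul, ← neg_neg (d' • (1 : K)), ← hc, hcst, smul_mul_smul_comm, one_mul, neg_mul_neg, ← sq,
          add_neg_cancel]
      rw [smul_eq_zero] at hsq
      rcases hsq with h | h
      · nlinarith [sq_nonneg (s / t)]
      · exact one_ne_zero h
  have hcard : Fintype.card (Fin 2) = Module.finrank ℚ K := by rw [Fintype.card_fin, hK]
  set bK : Module.Basis (Fin 2) ℚ K := basisOfLinearIndependentOfCardEqFinrank hli hcard with hbK
  have hbK0 : bK 0 = 1 := by rw [hbK, coe_basisOfLinearIndependentOfCardEqFinrank]; rfl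
  have hbK1 : bK 1 = c := by rw [hbK, coe_basisOfLinearIndependentOfCardEqFinrank]; rfl
  -- the linear map `x + yc ↦ x + yb`
  set f : K →ₗ[ℚ] R := bK.constr ℚ ![(1 : R), b] with hf
  have hf1 : f 1 = 1 := by
    rw [← hbK0, hf, Module.Basis.constr_basis]; rfl
  have hfc : f c = b := by
    rw [← hbK1, hf, Module.Basis.constr_basis]; rfl
  have hfxy : ∀ x y : ℚ, f (x • 1 + y • c) = x • 1 + y • b := fun x y => by
    rw [map_add, map_smul, map_smul, hf1, hfc]
  have hspan : ∀ z : K, ∃ x y : ℚ, z = x • 1 + y • c := fun z => by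
    refine ⟨bK.repr z 0, bK.repr z 1, ?_⟩
    conv_lhs => rw [← bK.sum_repr z]
    rw [Fin.sum_univ_two, hbK0, hbK1]
  refine ⟨{ toFun := f, map_one' := hf1, map_zero' := map_zero f, map_add' := map_add f, map_mul' := ?_ }⟩
  intro z w
  obtain ⟨x, y, rfl⟩ := hspan z
  obtain ⟨x', y', rfl⟩ := hspan w
  rw [quadratic_mul_expand hc, hfxy, hfxy, hfxy, quadratic_mul_expand hb]

variable {A E : AbelianVariety ℂ}

/-- `(endAlgebra.of φ)² = -d • 1` in `End⁰(A)` for `φ ≫ φ = -d`. [cite: MumfordAV1970, §19 Thm. 3] -/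
theorem endAlgebra_of_mul_self_eq_neg {φ : A ⟶ A} {d : ℕ} (hφ : φ ≫ φ = -(d • 𝟙 A)) :
    endAlgebra.of A φ * endAlgebra.of A φ = -((d : ℚ) • 1) := by
  set φ' : End A := φ with hφ'
  have h : φ' * φ' = -(d • (1 : End A)) := hφ
  rw [← map_mul, h, map_neg, map_nsmul, map_one, Nat.cast_smul_eq_nsmul]

/-- **«No embedding of `k = End⁰(E)` into (the centre of) `End⁰(X)`» ⟹ the rational independence `d ≠ q²d'`**: for an
elliptic curve `E` with `dim_ℚ End⁰(E) = 2` and `χ ≫ χ = -d'`, and `φ ∈ End(A)` with `φ ≫ φ = -d`, if there is no ring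
homomorphism `End⁰(E) → End⁰(A)` then `d ≠ q²d'` for every rational `q` (else `q⁻¹φ` has square `-d'` and §1
embeds `End⁰(E) = ℚ + ℚχ`). [cite: MoonenZarhin1999LowDim, §3 Prop. (3.8)] [cite: SilvermanAEC2009, III.9 Cor. 9.4] -/
theorem forall_ne_sq_mul_of_isEmpty_ringHom (hfor : IsEmpty (E.endAlgebra →+* A.endAlgebra))
    (hE2 : Module.finrank ℚ E.endAlgebra = 2) {χ : E ⟶ E} {d' : ℕ} (hd' : 0 < d') (hχ : χ ≫ χ = -(d' • 𝟙 E))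
    {φ : A ⟶ A} {d : ℕ} (hφ : φ ≫ φ = -(d • 𝟙 A)) (hd : 0 < d) : ∀ q : ℚ, (d : ℚ) ≠ q ^ 2 * d' := by
  intro q hq
  haveI : Module.Finite ℚ E.endAlgebra := AbelianVariety.finiteDimensional_endAlgebra_holds E
  haveI : Nontrivial E.endAlgebra := Module.nontrivial_of_finrank_pos (R := ℚ) (by rw [hE2]; norm_num)
  have hq0 : q ≠ 0 := by
    rintro rfl
    have h : (d : ℚ) = 0 := by rw [hq]; ring
    exact (Nat.cast_ne_zero.2 hd.ne') h
  have hd'Q : (0 : ℚ) < d' := Nat.cast_pos.2 hd'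
  have hc := endAlgebra_of_mul_self_eq_neg hχ
  have ha := endAlgebra_of_mul_self_eq_neg hφ
  -- `b := q⁻¹ φ` has `b² = -d'`
  have hb : (q⁻¹ • endAlgebra.of A φ) * (q⁻¹ • endAlgebra.of A φ) = -((d' : ℚ) • 1) := by
    rw [smul_mul_smul_comm, ha, smul_neg, smul_smul, hq]
    congr 2
    field_simp
  exact hfor.false (nonempty_ringHom_of_mul_self_eq_neg hE2 hd'Q hc hb).some

/-- `dim_ℚ End⁰(E) = 2` for an elliptic curve of CM type (`rank_ℤ End(E) = 2`, the tree's
`EllipticCurve.isOfCMType_iff_finrank_end_eq_two`, and `rank_ℤ End = dim_ℚ End⁰`). [cite: SilvermanAEC2009, III.9 Cor. 9.4]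
[cite: Milne1999, §2 p. 54] -/
theorem finrank_endAlgebra_eq_two_of_cmCurve (hE : E.dim = 1) (hEcm : IsOfCMType E) :
    Module.finrank ℚ E.endAlgebra = 2 := by
  rw [← AbelianVariety.finrank_int_end_eq_finrank_endAlgebra]
  exact (EllipticCurve.isOfCMType_iff_finrank_end_eq_two hE).1 hEcm

/-- A complex multiplication `χ ≫ χ = -d'`, `d' > 0`, on an elliptic curve of CM type (the tree's
`EllipticCurve.isOfCMType_iff_exists_mul_self_eq_neg`). [cite: SilvermanAEC2009, III.9 Cor. 9.4 and Example 9.1] -/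
theorem exists_hom_comp_self_eq_neg_of_cmCurve (hE : E.dim = 1) (hEcm : IsOfCMType E) :
    ∃ (χ : E ⟶ E) (d' : ℕ), 0 < d' ∧ χ ≫ χ = -(d' • 𝟙 E) := by
  obtain ⟨χ, d', hd', hχ⟩ := (EllipticCurve.isOfCMType_iff_exists_mul_self_eq_neg hE).1 hEcm
  refine ⟨χ, d', hd', ?_⟩
  change χ * χ = -(d' • (1 : End E))
  rw [hχ, nsmul_eq_mul, mul_one]

end Quadratic

/-! ### §2 The product span and condition (D) for `A × E` -/

section ProductSpanOpens

open MonoidalCategory CartesianMonoidalCategory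

section ProductSpan

variable {A B C Z : AbelianVariety ℂ} {n : ℕ} {gB : Fin n → (B ⟶ A)} {gC : Fin n → (Z ⟶ C)}

/-- **`HodgeClassesProductSpan B Z` for slots over `A × C`, `A` with `dim_ℚ End⁰(A) = 2`, `φ ≫ φ = -d`, `C` an
elliptic curve with `χ ≫ χ = -d'`, `d ≠ q²d'`** (Moonen–Zarhin (3.1) with Lemma (3.6) / Prop. (3.8), PROVED with
slots: `B` with `n` slots over `A`, `Z` with `n` slots over `C`, e.g. `B = A^{N+1}`, `Z = C^{N+1}`): every rational
class of Hodge type `(p,p)` on `B × Z` is a `ℂ`-combination of exterior products `pr_B^* a ⌣ pr_Z^* b` of RATIONAL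
HODGE classes — the tree's `hodgeClassesProductSpan_of_avSlots_of_thetaTrace` verbatim, fed by the invariance
theorem `AVSlots.exists_coeff_eq_zero_off_balanced_of_prod_quadraticEnd_cmCurve`.
[cite: MoonenZarhin1999LowDim, §3 (3.1), Lemma (3.6) and Prop. (3.8)] [cite: Lombardo2016, Lemma 3.4 (p. 1229)] -/
theorem hodgeClassesProductSpan_of_avSlots_of_quadraticEnd_cmCurve (hA0 : 0 < A.dim)
    (hA2 : Module.finrank ℚ A.endAlgebra = 2) (φA : A ⟶ A) {d : ℕ} (hd : 0 < d) (hφA : φA ≫ φA = -(d • 𝟙 A))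
    (hC1 : C.dim = 1) (χ : C ⟶ C) {d' : ℕ} (hd' : 0 < d') (hχ : χ ≫ χ = -(d' • 𝟙 C))
    (hfree : ∀ q : ℚ, (d : ℚ) ≠ q ^ 2 * d') (hgB : AVSlots A B gB) (hgC : AVSlots C Z gC) :
    HodgeClassesProductSpan B Z := by
  classical
  intro p c hcQ hc
  have hB : IsSmoothProjective B.dim B.X := Motives.AbelianVariety.isSmoothProjective_holds
  have hZ : IsSmoothProjective Z.dim Z.X := Motives.AbelianVariety.isSmoothProjective_holds
  have hXA : IsSmoothProjective A.dim A.X := Motives.AbelianVariety.isSmoothProjective_holds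
  have hXC : IsSmoothProjective C.dim C.X := Motives.AbelianVariety.isSmoothProjective_holds
  obtain ⟨hA, bA, h, cC, hbA0, hbA1, hcC0, hcC1, hmain⟩ :=
    (hgB.prodLift hgC).exists_coeff_eq_zero_off_balanced_of_prod_quadraticEnd_cmCurve hA0 hA2 φA hd hφA hC1 χ hd' hχ
      hfree
  have hc' : IsOfHodgeType (B.prod Z).dim (B.prod Z).X (2 * p) p p c := by
    rw [Motives.AbelianVariety.dim_prod]; exact hc
  rcases Nat.eq_zero_or_pos p with rfl | hp
  · -- degree `0`: `c = s · 1 = pr_B^*(s · 1_B) ⌣ pr_Z^* 1_Z`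
    have h1 : c ∈ Submodule.span ℂ {singularCohomology.one ℂ (ComplexPoints (B.X ⊗ Z.X))} :=
      mem_divisorClassesSpan_zero (N := B.dim + Z.dim) (IsSmoothProjective.tensor_holds hB hZ) c
    obtain ⟨s, hs⟩ := Submodule.mem_span_singleton.1 h1
    refine mem_span_hodgeProductClasses_of_mem_span_pureType B Z hcQ hc (Submodule.subset_span ?_)
    refine ⟨0, 0, rfl, s • singularCohomology.one ℂ (ComplexPoints B.X), singularCohomology.one ℂ (ComplexPoints Z.X),
      ⟨0, rfl, isOfHodgeType_zero_zero_of_degree_zero hB _⟩,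
      ⟨0, 0, rfl, isOfHodgeType_zero_zero_of_degree_zero hZ _⟩, ?_⟩
    rw [← hs, map_smul, LinearMap.map_smul₂]
    erw [singularCohomology.map_one, singularCohomology.map_one, cupProduct_one]
  · obtain ⟨a, hca, hkill⟩ := hmain hp hcQ hc'
    -- the letters of `B × Z` over `A × C` are `pr_B^*`(letters of `B` over `A`) and `pr_Z^*`(letters of `Z` over `C`)
    set xA : (Fin n × Fin hA) × Fin 2 → complexBetti B.X 1 := fun jr =>
      complexBetti.map (gB jr.1.1).hom.hom.hom 1 (ofRatClassBaseChange (ComplexPoints A.X) 1 (bA (jr.1.2, jr.2)))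
      with hxA
    set y : (Fin n × Fin h) × Fin 2 → complexBetti Z.X 1 := fun jr =>
      complexBetti.map (gC jr.1.1).hom.hom.hom 1 (ofRatClassBaseChange (ComplexPoints C.X) 1 (cC (jr.1.2, jr.2)))
      with hy
    have hletters : (fun jr : (Fin n × (Fin hA ⊕ Fin h)) × Fin 2 => complexBetti.map
        (Motives.AbelianVariety.prodLift (Motives.AbelianVariety.fst B Z ≫ gB jr.1.1)
          (Motives.AbelianVariety.snd B Z ≫ gC jr.1.1)).hom.hom.hom 1
        (Sum.elim
          (fun i => complexBetti.map (Motives.AbelianVariety.fst A C).hom.hom.hom 1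
            (ofRatClassBaseChange (ComplexPoints A.X) 1 (bA (i, jr.2))))
          (fun i => complexBetti.map (Motives.AbelianVariety.snd A C).hom.hom.hom 1
            (ofRatClassBaseChange (ComplexPoints C.X) 1 (cC (i, jr.2))))
          jr.1.2)) =
        fun jr : (Fin n × (Fin hA ⊕ Fin h)) × Fin 2 => Sum.elim
          (fun i => complexBetti.map (Motives.AbelianVariety.fst B Z).hom.hom.hom 1 (xA ((jr.1.1, i), jr.2)))
          (fun i => complexBetti.map (Motives.AbelianVariety.snd B Z).hom.hom.hom 1 (y ((jr.1.1, i), jr.2)))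
          jr.1.2 := by
      funext jr
      obtain ⟨⟨j, t⟩, κ⟩ := jr
      rcases t with i | i
      · simp only [Sum.elim_inl, hxA]
        rw [complexBetti_map_map_hom, complexBetti_map_map_hom, Motives.AbelianVariety.prodLift_fst]
      · simp only [Sum.elim_inr, hy]
        rw [complexBetti_map_map_hom, complexBetti_map_map_hom, Motives.AbelianVariety.prodLift_snd]
    -- types of the letters
    have hxA0 : ∀ jr : (Fin n × Fin hA) × Fin 2, jr.2 = 0 → IsOfHodgeType B.dim B.X 1 1 0 (xA jr) := by
      rintro ⟨⟨j, i⟩, κ⟩ hκ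
      change κ = 0 at hκ
      subst hκ
      exact (hbA0 i).map_of_isSmoothProjective hB hXA _
    have hxA1 : ∀ jr : (Fin n × Fin hA) × Fin 2, jr.2 = 1 → IsOfHodgeType B.dim B.X 1 0 1 (xA jr) := by
      rintro ⟨⟨j, i⟩, κ⟩ hκ
      change κ = 1 at hκ
      subst hκ
      exact (hbA1 i).map_of_isSmoothProjective hB hXA _
    have hy0 : ∀ jr : (Fin n × Fin h) × Fin 2, jr.2 = 0 → IsOfHodgeType Z.dim Z.X 1 1 0 (y jr) := by
      rintro ⟨⟨j, i⟩, κ⟩ hκ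
      change κ = 0 at hκ
      subst hκ
      exact (hcC0 i).map_of_isSmoothProjective hZ hXC _
    have hy1 : ∀ jr : (Fin n × Fin h) × Fin 2, jr.2 = 1 → IsOfHodgeType Z.dim Z.X 1 0 1 (y jr) := by
      rintro ⟨⟨j, i⟩, κ⟩ hκ
      change κ = 1 at hκ
      subst hκ
      exact (hcC1 i).map_of_isSmoothProjective hZ hXC _
    -- evaluate and feed the typed criterion
    have hmem := wordEval_mem_span_typed_cup_pureType_of_eq_zero_off_balanced
      (Motives.AbelianVariety.fst B Z) (Motives.AbelianVariety.snd B Z) xA y hxA0 hxA1 hy0 hy1 hkill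
    rw [← hletters, hca] at hmem
    refine mem_span_hodgeProductClasses_of_mem_span_pureType B Z hcQ hc (Submodule.span_mono ?_ hmem)
    rintro z ⟨i, j, hij, d, μ, hd, hμ, rfl⟩
    exact ⟨i, j, hij, d, μ, hd, hμ, rfl⟩

/-- **Equal powers**: `HodgeClassesProductSpan (A^{N+1}) (C^{N+1})` (by slots `AVSlots.powSucc` on both sides).
[cite: MoonenZarhin1999LowDim, §3 (3.1) and Prop. (3.8)] [cite: Lombardo2016, Lemma 3.4 (p. 1229)] -/
theorem hodgeClassesProductSpan_powSucc_powSucc_of_quadraticEnd_cmCurve (hA0 : 0 < A.dim)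
    (hA2 : Module.finrank ℚ A.endAlgebra = 2) (φA : A ⟶ A) {d : ℕ} (hd : 0 < d) (hφA : φA ≫ φA = -(d • 𝟙 A))
    (hC1 : C.dim = 1) (χ : C ⟶ C) {d' : ℕ} (hd' : 0 < d') (hχ : χ ≫ χ = -(d' • 𝟙 C))
    (hfree : ∀ q : ℚ, (d : ℚ) ≠ q ^ 2 * d') (N : ℕ) : HodgeClassesProductSpan (A.powSucc N) (C.powSucc N) :=
  hodgeClassesProductSpan_of_avSlots_of_quadraticEnd_cmCurve hA0 hA2 φA hd hφA hC1 χ hd' hχ hfree (AVSlots.powSucc A N)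
    (AVSlots.powSucc C N)

/-- One slot on each side: `HodgeClassesProductSpan A C`. [cite: MoonenZarhin1999LowDim, §3 (3.1) and Prop. (3.8)] -/
theorem hodgeClassesProductSpan_of_quadraticEnd_cmCurve (hA0 : 0 < A.dim) (hA2 : Module.finrank ℚ A.endAlgebra = 2)
    (φA : A ⟶ A) {d : ℕ} (hd : 0 < d) (hφA : φA ≫ φA = -(d • 𝟙 A)) (hC1 : C.dim = 1) (χ : C ⟶ C) {d' : ℕ}
    (hd' : 0 < d') (hχ : χ ≫ χ = -(d' • 𝟙 C)) (hfree : ∀ q : ℚ, (d : ℚ) ≠ q ^ 2 * d') :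
    HodgeClassesProductSpan A C :=
  hodgeClassesProductSpan_of_avSlots_of_quadraticEnd_cmCurve hA0 hA2 φA hd hφA hC1 χ hd' hχ hfree (avSlots_self A)
    (avSlots_self C)

end ProductSpan

end ProductSpanOpens

section ConditionD

variable {A C : AbelianVariety ℂ}

/-- **Condition (D) for `A × E`**: if `A` is stably nondegenerate, `dim_ℚ End⁰(A) = 2` with `φ ≫ φ = -d`, and `E` is
an elliptic curve with `χ ≫ χ = -d'`, `d ≠ q²d'`, then `A × E` is stably nondegenerate («`Hg(X × E) = Hg(X) × Hg(E)`»
and Thm. (3.2): product span on all equal powers + (D) for both factors; an elliptic curve is (D)).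
[cite: MoonenZarhin1999LowDim, §3 Thm. (3.2), Lemma (3.6) and Prop. (3.8)] [cite: Gordon1999HodgeAVSurvey, Def. 7.6] -/
theorem IsStablyNondegenerate.prod_cmCurve_of_quadraticEnd (hA : IsStablyNondegenerate A) (hA0 : 0 < A.dim)
    (hA2 : Module.finrank ℚ A.endAlgebra = 2) (φA : A ⟶ A) {d : ℕ} (hd : 0 < d) (hφA : φA ≫ φA = -(d • 𝟙 A))
    (hC1 : C.dim = 1) (χ : C ⟶ C) {d' : ℕ} (hd' : 0 < d') (hχ : χ ≫ χ = -(d' • 𝟙 C))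
    (hfree : ∀ q : ℚ, (d : ℚ) ≠ q ^ 2 * d') : IsStablyNondegenerate (A.prod C) :=
  isStablyNondegenerate_prod_of_forall_productSpan_powSucc A C
    (fun N => hodgeClassesProductSpan_powSucc_powSucc_of_quadraticEnd_cmCurve hA0 hA2 φA hd hφA hC1 χ hd' hχ hfree N) hA
    (EllipticCurve.isStablyNondegenerate hC1)

/-- The order `E × A`. [cite: MoonenZarhin1999LowDim, §3 Thm. (3.2) and Prop. (3.8)] -/
theorem IsStablyNondegenerate.cmCurve_prod_of_quadraticEnd (hA : IsStablyNondegenerate A) (hA0 : 0 < A.dim)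
    (hA2 : Module.finrank ℚ A.endAlgebra = 2) (φA : A ⟶ A) {d : ℕ} (hd : 0 < d) (hφA : φA ≫ φA = -(d • 𝟙 A))
    (hC1 : C.dim = 1) (χ : C ⟶ C) {d' : ℕ} (hd' : 0 < d') (hχ : χ ≫ χ = -(d' • 𝟙 C))
    (hfree : ∀ q : ℚ, (d : ℚ) ≠ q ^ 2 * d') : IsStablyNondegenerate (C.prod A) :=
  (hA.prod_cmCurve_of_quadraticEnd hA0 hA2 φA hd hφA hC1 χ hd' hχ hfree).of_isIsogenous (isIsogenous_prod_swap C A)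

/-- **Condition (D) for `A × E` from «no embedding `End⁰(E) ↪ End⁰(A)`»** (`A` stably nondegenerate with
`dim_ℚ End⁰(A) = 2`, `φ ≫ φ = -d`; `E` an elliptic curve of CM type). [cite: MoonenZarhin1999LowDim, §3 Thm. (3.2) and Prop. (3.8)] -/
theorem IsStablyNondegenerate.cmCurve_prod_of_quadraticEnd_of_isEmpty (hA : IsStablyNondegenerate A) (hA0 : 0 < A.dim)
    (hA2 : Module.finrank ℚ A.endAlgebra = 2) (φA : A ⟶ A) {d : ℕ} (hd : 0 < d) (hφA : φA ≫ φA = -(d • 𝟙 A))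
    (hC1 : C.dim = 1) (hCcm : IsOfCMType C) (hfor : IsEmpty (C.endAlgebra →+* A.endAlgebra)) :
    IsStablyNondegenerate (C.prod A) := by
  obtain ⟨χ, d', hd', hχ⟩ := exists_hom_comp_self_eq_neg_of_cmCurve hC1 hCcm
  exact hA.cmCurve_prod_of_quadraticEnd hA0 hA2 φA hd hφA hC1 χ hd' hχ
    (forall_ne_sq_mul_of_isEmpty_ringHom hfor (finrank_endAlgebra_eq_two_of_cmCurve hC1 hCcm) hd' hχ hφA hd)

end ConditionD

/-! ### §3 The `E × T` row of Thm. 0.1 (4) for `T` a simple abelian threefold -/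

section Threefold

variable {A E T F : AbelianVariety ℂ}

/-- **Condition (D) for `E × A`, `A` SIMPLE and stably nondegenerate with `dim_ℚ End⁰(A) = 2`, `E` an elliptic curve of
CM type admitting no ring homomorphism `End⁰(E) → End⁰(A)`** — `End⁰(A)` is a quadratic field (Mumford §19 Cor. 2):
totally real ⟹ no factor of type IV and the tree's R5 `IsStablyNondegenerate.prod_cmCurve_of_hasNoTypeIVFactor`
(Thm. (3.2)(2)); imaginary ⟹ `End⁰(A) = ℚ(φ)`, `φ ≫ φ = -d`, and §2 (Prop. (3.8)).
[cite: MoonenZarhin1999LowDim, §3 Thm. (3.2), Lemma (3.6) and Prop. (3.8)] [cite: MumfordAV1970, §19 Cor. 2 of Thm. 1 (p. 174)] -/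
theorem IsStablyNondegenerate.cmCurve_prod_of_isSimple_of_finrank_eq_two_of_isEmpty (hA : IsStablyNondegenerate A)
    (hAs : A.IsSimple) (hA0 : 0 < A.dim) (hA2 : Module.finrank ℚ A.endAlgebra = 2) (hE : E.dim = 1)
    (hEcm : IsOfCMType E) (hfor : IsEmpty (E.endAlgebra →+* A.endAlgebra)) : IsStablyNondegenerate (E.prod A) := by
  classical
  have hF : IsField A.endAlgebra := AbelianVariety.isField_endAlgebra_of_isSimple_of_finrank_eq_two hAs hA0 hA2
  by_cases hR : IsTotallyReal (EndField A hF)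
  · exact (hA.prod_cmCurve_of_hasNoTypeIVFactor (hasNoTypeIVFactor_of_isTotallyReal A hF) hE hEcm).of_isIsogenous
      (isIsogenous_prod_swap E A)
  · obtain ⟨a, q, hq, ha⟩ := AbelianVariety.exists_mul_self_eq_neg_of_finrank_eq_two hA0 hA2 hF hR
    obtain ⟨φ, d, hd, hφ⟩ := AbelianVariety.exists_hom_comp_self_eq_neg A hq ha
    exact hA.cmCurve_prod_of_quadraticEnd_of_isEmpty hA0 hA2 φ hd hφ hE hEcm hfor

/-- **`E × A` for `A` of RIBET TYPE: `E` an elliptic curve of CM type, `A` with `dim A ≥ 3`, `dim_ℚ End⁰(A) = 2`,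
`φ ≫ φ = -d` acting on `H^{1,0}(A)` with multiplicities `(dim A - 1, 1)` (then `B•(Aⁿ) = D•(Aⁿ)`, Ribet 1983 Thm. 3 —
the tree's `AbelianVariety.isDivisorGenerated_powSucc_of_ribetTypeOne`), and NO ring homomorphism `End⁰(E) → End⁰(A)`:
`E × A` is stably nondegenerate.** For `dim A = 4` this is the FIVEFOLD row of Thm. 0.2 (4) complementary to case (g)
(«`X₂` a simple abelian fourfold such that there exists an embedding `k ↪ End⁰(X₂)` via which `k` acts on `T_{X₂,0}`
with multiplicities `(1,3)`»); multiplicities `(2,2)` is case (b) for `A`.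
[cite: MoonenZarhin1999LowDim, Thm. 0.2 (4) with (g) and §3 Prop. (3.8)] [cite: Ribet1983, Thm. 3] -/
theorem isStablyNondegenerate_cmCurve_prod_of_ribetTypeOne_of_isEmpty (hE : E.dim = 1) (hEcm : IsOfCMType E)
    (hF3 : 3 ≤ F.dim) (h2 : Module.finrank ℚ F.endAlgebra = 2) (φ : F ⟶ F) {d : ℕ} (hd : 0 < d)
    (hφ : φ ≫ φ = -(d • 𝟙 F))
    (h1 : eigenMultiplicity F φ (Complex.I * (Real.sqrt d : ℂ)) = 1 ∨
      eigenMultiplicity F φ (-(Complex.I * (Real.sqrt d : ℂ))) = 1)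
    (hfor : IsEmpty (E.endAlgebra →+* F.endAlgebra)) : IsStablyNondegenerate (E.prod F) :=
  have hFD : IsStablyNondegenerate F := fun N =>
    AbelianVariety.isDivisorGenerated_powSucc_of_ribetTypeOne F φ hd hφ h2 h1 hF3 N
  hFD.cmCurve_prod_of_quadraticEnd_of_isEmpty (by omega) h2 φ hd hφ hE hEcm hfor

/-- **The Hodge conjecture for every power of everything isogenous to `E × A`, `A` of Ribet type `(dim A - 1, 1)`,
`End⁰(E) ↪̸ End⁰(A)`** — for `dim A = 4`: abelian FIVEFOLDS outside case (g), UNCONDITIONALLY.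
[cite: MoonenZarhin1999LowDim, Thm. 0.2 (4)] [cite: vanGeemen1994HodgeAV, Lemma 3.7] -/
theorem hodgeConjectureFor_of_isIsogenous_powSucc_cmCurve_prod_of_ribetTypeOne_of_isEmpty (hE : E.dim = 1)
    (hEcm : IsOfCMType E) (hF3 : 3 ≤ F.dim) (h2 : Module.finrank ℚ F.endAlgebra = 2) (φ : F ⟶ F) {d : ℕ}
    (hd : 0 < d) (hφ : φ ≫ φ = -(d • 𝟙 F))
    (h1 : eigenMultiplicity F φ (Complex.I * (Real.sqrt d : ℂ)) = 1 ∨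
      eigenMultiplicity F φ (-(Complex.I * (Real.sqrt d : ℂ))) = 1)
    (hfor : IsEmpty (E.endAlgebra →+* F.endAlgebra)) {X : AbelianVariety ℂ} {N : ℕ}
    (hX : AbelianVariety.IsIsogenous X ((E.prod F).powSucc N)) : HodgeConjectureFor X.dim X.X :=
  (isStablyNondegenerate_cmCurve_prod_of_ribetTypeOne_of_isEmpty hE hEcm hF3 h2 φ hd hφ h1 hfor)
    |>.hodgeConjectureFor_of_isIsogenous_powSucc hX

/-- **A simple abelian threefold with `dim_ℚ End⁰(T) = 2` carries `φ ≫ φ = -d`, `d > 0`** (`End⁰(T)` is a quadratic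
field — Mumford §19 Cor. 2 — NOT totally real, since `[F:ℚ] ∣ dim T` for totally real `F` and `2 ∤ 3`; type IV(1,1)).
[cite: MoonenZarhin1999LowDim, §2 (2.3) type IV(1,1)] [cite: Shimura1998, §5.1 Proposition 5 (p. 36)] -/
theorem exists_hom_comp_self_eq_neg_of_isSimple_threefold_of_finrank_eq_two (hT : T.IsSimple) (hT3 : T.dim = 3)
    (h2 : Module.finrank ℚ T.endAlgebra = 2) : ∃ (φ : T ⟶ T) (d : ℕ), 0 < d ∧ φ ≫ φ = -(d • 𝟙 T) := by
  classical
  have h0 : 0 < T.dim := by omega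
  have hF : IsField T.endAlgebra := AbelianVariety.isField_endAlgebra_of_isSimple_of_finrank_eq_two hT h0 h2
  have hnR : ¬ IsTotallyReal (EndField T hF) := fun hR => by
    have h := finrank_endAlgebra_dvd_dim_of_isField_of_isTotallyReal hF h0 hR
    rw [h2, hT3] at h
    omega
  obtain ⟨a, q, hq, ha⟩ := AbelianVariety.exists_mul_self_eq_neg_of_finrank_eq_two h0 h2 hF hnR
  exact AbelianVariety.exists_hom_comp_self_eq_neg T hq ha

/-- A simple abelian threefold with `dim_ℚ End⁰(T) = 6` is of CM type (`End⁰(T)` is commutative — a skew field of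
`ℚ`-dimension `6` is a field, Wedderburn — of degree `6 = 2 dim T`; Shimura §5.1 Prop. 1).
[cite: MoonenZarhin1999LowDim, §2 (2.3) type IV(3,1)] [cite: Shimura1998, §5.1 Proposition 1] -/
theorem isOfCMType_of_isSimple_threefold_of_finrank_eq_six (hT : T.IsSimple) (hT3 : T.dim = 3)
    (h6 : Module.finrank ℚ T.endAlgebra = 6) : IsOfCMType T :=
  (isOfCMType_iff_finrank_eq_of_comm (AbelianVariety.mul_comm_endAlgebra_of_isSimple_of_finrank_eq_six hT h6)).2
    (by rw [h6, hT3])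

/-- A simple abelian threefold with `dim_ℚ End⁰(T) = 3` has no factor of type IV (`End⁰(T)` a totally real cubic
field). [cite: MoonenZarhin1999LowDim, §2 (2.3) type I(3)] [cite: MumfordAV1970, §21 Thm. 2] -/
theorem hasNoTypeIVFactor_of_isSimple_threefold_of_finrank_eq_three (hT : T.IsSimple) (hT3 : T.dim = 3)
    (h3 : Module.finrank ℚ T.endAlgebra = 3) : HasNoTypeIVFactor T := by
  have h0 : 0 < T.dim := by omega
  have hF : IsField T.endAlgebra := AbelianVariety.isField_endAlgebra_of_isSimple_of_finrank_eq_three hT h0 h3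
  haveI := AbelianVariety.isTotallyReal_endField_of_finrank_odd h0 hF (by rw [h3]; exact ⟨1, rfl⟩)
  exact hasNoTypeIVFactor_of_isTotallyReal T hF

/-- **THE NEW ROW (Moonen–Zarhin Thm. 0.1 (4) for `E_k × T`, `T` simple of type IV(1,1)): for an elliptic curve `E` of
CM type and a SIMPLE abelian threefold `T` with `dim_ℚ End⁰(T) = 2` (so `End⁰(T) = k'` imaginary quadratic, `T` NOT
of CM type) admitting NO ring homomorphism `End⁰(E) → End⁰(T)` (`k ≇ k'`), `E × T` is stably nondegenerate** —
`B•((E × T)ⁿ) = D•((E × T)ⁿ)` for all `n` (`T` is (D) by the tree's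
`AbelianVariety.isStablyNondegenerate_of_isSimple_threefold_of_finrank_eq_two`, and §2).
[cite: MoonenZarhin1999LowDim, Thm. 0.1 (4), §2 (2.3) and §3 Prop. (3.8)] [cite: Gordon1999HodgeAVSurvey, Def. 7.6] -/
theorem isStablyNondegenerate_cmCurve_prod_of_isSimple_threefold_of_finrank_eq_two_of_isEmpty (hE : E.dim = 1)
    (hEcm : IsOfCMType E) (hT : T.IsSimple) (hT3 : T.dim = 3) (h2 : Module.finrank ℚ T.endAlgebra = 2)
    (hfor : IsEmpty (E.endAlgebra →+* T.endAlgebra)) : IsStablyNondegenerate (E.prod T) :=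
  (AbelianVariety.isStablyNondegenerate_of_isSimple_threefold_of_finrank_eq_two T hT hT3 h2)
    |>.cmCurve_prod_of_isSimple_of_finrank_eq_two_of_isEmpty hT (by omega) h2 hE hEcm hfor

/-- **THE `E × T` ROW OF THM. 0.1 (4) FOR `T` SIMPLE AND `E` OF CM TYPE, COMPLETE: for an elliptic curve `E` of CM
type and a SIMPLE complex abelian threefold `T` admitting NO ring homomorphism `End⁰(E) → End⁰(T)`, `E × T` is stably
nondegenerate.** `dim_ℚ End⁰(T) ∈ {1, 2, 3, 6}`: `1` and `3` — no factor of type IV (the tree's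
`isStablyNondegenerate_prod_cmCurve_of_isSimple_threefold_of_hasNoTypeIVFactor`); `6` — `T` of CM type (the tree's
`isStablyNondegenerate_cmCurve_prod_of_isSimple_threefold_of_isOfCMType_of_isEmpty`); `2` — the new row.
[cite: MoonenZarhin1999LowDim, Thm. 0.1 (4), §2 (2.3), p. 715 and §3 Prop. (3.8)] [cite: Gordon1999HodgeAVSurvey, Thm. 7.5 and Def. 7.6] -/
theorem isStablyNondegenerate_cmCurve_prod_of_isSimple_threefold_of_isEmpty (hE : E.dim = 1) (hEcm : IsOfCMType E)
    (hT : T.IsSimple) (hT3 : T.dim = 3) (hfor : IsEmpty (E.endAlgebra →+* T.endAlgebra)) :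
    IsStablyNondegenerate (E.prod T) := by
  rcases AbelianVariety.finrank_endAlgebra_mem_of_isSimple_threefold hT hT3 with h1 | h2 | h3 | h6
  · exact (isStablyNondegenerate_prod_cmCurve_of_isSimple_threefold_of_hasNoTypeIVFactor hT hT3
      (hasNoTypeIVFactor_of_finrank_endAlgebra_eq_one h1) hE hEcm).of_isIsogenous (isIsogenous_prod_swap E T)
  · exact isStablyNondegenerate_cmCurve_prod_of_isSimple_threefold_of_finrank_eq_two_of_isEmpty hE hEcm hT hT3 h2 hfor
  · exact (isStablyNondegenerate_prod_cmCurve_of_isSimple_threefold_of_hasNoTypeIVFactor hT hT3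
      (hasNoTypeIVFactor_of_isSimple_threefold_of_finrank_eq_three hT hT3 h3) hE hEcm).of_isIsogenous
      (isIsogenous_prod_swap E T)
  · exact isStablyNondegenerate_cmCurve_prod_of_isSimple_threefold_of_isOfCMType_of_isEmpty hE hEcm hT hT3
      (isOfCMType_of_isSimple_threefold_of_finrank_eq_six hT hT3 h6) hfor

/-- The order `T × E`. [cite: MoonenZarhin1999LowDim, Thm. 0.1 (4) and Prop. (3.8)] -/
theorem isStablyNondegenerate_prod_cmCurve_of_isSimple_threefold_of_isEmpty (hE : E.dim = 1) (hEcm : IsOfCMType E)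
    (hT : T.IsSimple) (hT3 : T.dim = 3) (hfor : IsEmpty (E.endAlgebra →+* T.endAlgebra)) :
    IsStablyNondegenerate (T.prod E) :=
  (isStablyNondegenerate_cmCurve_prod_of_isSimple_threefold_of_isEmpty hE hEcm hT hT3 hfor).of_isIsogenous
    (isIsogenous_prod_swap T E)

/-- **EVERY elliptic curve times a simple abelian threefold, outside case (a)**: for an elliptic curve `E` and a
simple complex abelian threefold `T` such that, IF `E` is of CM type, there is no ring homomorphism
`End⁰(E) → End⁰(T)`, `E × T` is stably nondegenerate (`E` not of CM type: `End⁰(E) = ℚ`, the tree's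
`isStablyNondegenerate_nonCMCurve_prod_threefold`, Lemma (3.4); `E` of CM type: the previous theorem, Prop. (3.8)).
[cite: MoonenZarhin1999LowDim, Thm. 0.1 (4), Lemma (3.4) and Prop. (3.8)] [cite: vanGeemen1994HodgeAV, Thm. 4.3] -/
theorem isStablyNondegenerate_curve_prod_of_isSimple_threefold (hE : E.dim = 1) (hT : T.IsSimple) (hT3 : T.dim = 3)
    (hfor : IsOfCMType E → IsEmpty (E.endAlgebra →+* T.endAlgebra)) : IsStablyNondegenerate (E.prod T) := by
  by_cases hEcm : IsOfCMType E
  · exact isStablyNondegenerate_cmCurve_prod_of_isSimple_threefold_of_isEmpty hE hEcm hT hT3 (hfor hEcm)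
  · exact isStablyNondegenerate_nonCMCurve_prod_threefold hT3 hE
      (finrank_endAlgebra_eq_one_of_curve_of_not_isOfCMType hE hEcm)

/-- `B = D` on every power `(E × T)^{N+1}`. [cite: MoonenZarhin1999LowDim, Thm. 0.1 (4)] -/
theorem isDivisorGenerated_powSucc_curve_prod_of_isSimple_threefold (hE : E.dim = 1) (hT : T.IsSimple)
    (hT3 : T.dim = 3) (hfor : IsOfCMType E → IsEmpty (E.endAlgebra →+* T.endAlgebra)) (N : ℕ) :
    IsDivisorGenerated ((E.prod T).powSucc N) :=
  isStablyNondegenerate_curve_prod_of_isSimple_threefold hE hT hT3 hfor N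

/-- **The Hodge conjecture for every power `(E × T)^{N+1}`** of an elliptic curve times a simple abelian threefold
outside case (a) — UNCONDITIONALLY (no HC_CM). [cite: MoonenZarhin1999LowDim, Thm. 0.1 (4)] [cite: vanGeemen1994HodgeAV, §2.4 and Lemma 3.7] -/
theorem hodgeConjectureFor_powSucc_curve_prod_of_isSimple_threefold (hE : E.dim = 1) (hT : T.IsSimple)
    (hT3 : T.dim = 3) (hfor : IsOfCMType E → IsEmpty (E.endAlgebra →+* T.endAlgebra)) (N : ℕ) :
    HodgeConjectureFor ((E.prod T).powSucc N).dim ((E.prod T).powSucc N).X :=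
  (isStablyNondegenerate_curve_prod_of_isSimple_threefold hE hT hT3 hfor).hodgeConjectureFor_powSucc N

/-- **The Hodge conjecture for the abelian FOURFOLD `E × T` itself.** [cite: MoonenZarhin1999LowDim, Thm. 0.1 (4)] -/
theorem hodgeConjectureFor_curve_prod_of_isSimple_threefold (hE : E.dim = 1) (hT : T.IsSimple) (hT3 : T.dim = 3)
    (hfor : IsOfCMType E → IsEmpty (E.endAlgebra →+* T.endAlgebra)) :
    HodgeConjectureFor (E.prod T).dim (E.prod T).X :=
  (isStablyNondegenerate_curve_prod_of_isSimple_threefold hE hT hT3 hfor).hodgeConjectureFor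

/-- **Everything isogenous to a power of `E × T`** (van Geemen Lemma 3.7) is stably nondegenerate and satisfies the
Hodge conjecture. [cite: MoonenZarhin1999LowDim, Thm. 0.1 (4)] [cite: vanGeemen1994HodgeAV, Lemma 3.7 and §3.6] -/
theorem isStablyNondegenerate_of_isIsogenous_curve_prod_of_isSimple_threefold (hE : E.dim = 1) (hT : T.IsSimple)
    (hT3 : T.dim = 3) (hfor : IsOfCMType E → IsEmpty (E.endAlgebra →+* T.endAlgebra)) {X : AbelianVariety ℂ}
    (hX : AbelianVariety.IsIsogenous X (E.prod T)) : IsStablyNondegenerate X :=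
  (isStablyNondegenerate_curve_prod_of_isSimple_threefold hE hT hT3 hfor).of_isIsogenous hX

/-- The Hodge conjecture for everything isogenous to a power of `E × T`. [cite: MoonenZarhin1999LowDim, Thm. 0.1 (4)]
[cite: vanGeemen1994HodgeAV, Lemma 3.7] -/
theorem hodgeConjectureFor_of_isIsogenous_powSucc_curve_prod_of_isSimple_threefold (hE : E.dim = 1)
    (hT : T.IsSimple) (hT3 : T.dim = 3) (hfor : IsOfCMType E → IsEmpty (E.endAlgebra →+* T.endAlgebra))
    {X : AbelianVariety ℂ} {N : ℕ} (hX : AbelianVariety.IsIsogenous X ((E.prod T).powSucc N)) :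
    HodgeConjectureFor X.dim X.X :=
  (isStablyNondegenerate_curve_prod_of_isSimple_threefold hE hT hT3 hfor).hodgeConjectureFor_of_isIsogenous_powSucc hX

/- **On path**: the Hodge conjecture gives every target of this file — the tree's
`hodgeConjectureFor_prod_of_hodgeConjecture'` (`ThetaTraceTimesCMProductSpan`), not re-declared (gate dedup). -/
example (h : ∀ ⦃n : ℕ⦄ ⦃X : Motives.SchemeOver ℂ⦄, Motives.IsSmoothProjective n X → HodgeConjectureFor n X)
    (E T : AbelianVariety ℂ) : HodgeConjectureFor (E.prod T).dim (E.prod T).X :=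
  hodgeConjectureFor_prod_of_hodgeConjecture' h E T

end Threefold

end Literature.AlgebraicGeometry.HodgeTheory

end
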